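import Mathlib.Algebra.MvPolynomial.Equiv
import Mathlib.Algebra.Polynomial.Roots
import Literature.Computability.AlgebraicComplexity.KabanetsImpagliazzoGenerator
import Literature.Computability.AlgebraicComplexity.RootLifting
import HarnessLib

/-!
# The Kabanets–Impagliazzo generator, II: a hard polynomial makes `KI-gen` a hitting set
# generator — UNCONDITIONALLY (KI 2003 Lemma 28/30; KRST 2022 Lemma 8; root closure)

Topic `Computability/AlgebraicComplexity`. Continuation of `KabanetsImpagliazzoGenerator.lean`
(Part I, the hybrid argument: a nonzero annihilator `D` of `KI-gen(f)` yields a nonzero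
`H(x, c)` of controlled size and degree with `H(x, f(x)) = 0`).

**Part II here.** Kabanets–Impagliazzo finish with Kaltofen's factor theorem applied to the factor
`c - f(x)` of `H` (their Lemma 28 + Thm. 27 / Cor. 29). The tree PROVES the root case of
Kaltofen's theorem (`RootLifting.lean`, `complexity_le_pow_of_isRoot`: Newton iteration, after
Dvir–Shpilka–Yehudayoff / Dutta–Saxena–Sinhababu / Bürgisser), so everything below is
unconditional over a field of characteristic zero:

* `X_sub_rename_dvd_of_root` — **Gauss' lemma in KI's form (Lemma 28)**, PROVED (kept for the
  record; the root bound below does not go through divisibility): if `H(x, f(x)) = 0` then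
  `c - f(x)` divides `H` in `F[x, c]`.
* `complexity_le_of_kiGenerator_annihilated` — **KI Lemma 30** (sizes only, tree constants): if
  the blocks meet pairwise in `≤ r` points and a nonzero `D` annihilates `KI-gen(f)` then
  `L(f) ≤ (L(D) + #ι·(deg f + 1)^r (2 deg f + 2) + deg D · max 1 (deg f) + deg f + #β + 4)^7`
  (`#β` = number of variables of `f`; the exponent `7` is the root-closure exponent).
* `kiGenerator_isHittingSetGenerator` — **KRST Lemma 8 ("HSG from hardness")**, contrapositive:
  if `L(f)` exceeds that bound (with `s, Δ` for `L(D), deg D`) then `D ∘ KI-gen(f) ≠ 0` for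
  every nonzero `D` with `L(D) ≤ s`, `deg D ≤ Δ`.

Characteristic zero is used by the root closure (and gives the infinite field the hybrid argument
needs). Constants differ from print (total degree in place of individual degree; KI's exponent
`0.1` — Kaltofen's exponent — is here the explicit `1/7`).

## References

* [KabanetsImpagliazzo2003] V. Kabanets, R. Impagliazzo, *Derandomizing polynomial identity tests
  means proving circuit lower bounds*, STOC 2003, Thm. 27, Lemma 28, Cor. 29, Lemma 30.
* [KumarRamyaSaptharishiTengse2022] M. Kumar, C. Ramya, R. Saptharishi, A. Tengse, *If VNP is
  hard, then so are equations for it*, STACS 2022, Lemma 8.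
* [DuttaSaxenaSinhababu2018] P. Dutta, N. Saxena, A. Sinhababu, *Discovering the roots: uniform
  closure results for algebraic classes under factoring*, STOC 2018, §1.3 (the Newton iteration
  behind `RootLifting.lean`).
-/

noncomputable section

namespace Literature.Computability.AlgebraicComplexity

open MvPolynomial Finset Literature.Computability.MetaComplexity

/-! ### Part II: factoring (KI Lemma 28 + Kaltofen) -/

section Factoring

variable {F : Type*} [Field F] {β : Type*}

/-- **Gauss (KI Lemma 28), factor-theorem form**: if `H(x, f(x)) = 0` then `c - f(x)` divides
`H(x, c)` in `F[x, c]` (the factor theorem in `F[x][c]`, transported along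
`MvPolynomial.optionEquivLeft`). [cite: KabanetsImpagliazzo2003, Lemma 28] -/
theorem X_sub_rename_dvd_of_root (f : MvPolynomial β F) {H : MvPolynomial (Option β) F}
    (hroot : bind₁ (fun o => o.elim f X) H = 0) :
    (X none - rename some f) ∣ H := by
  -- the substitution `c ↦ f` is evaluation of `optionEquivLeft H ∈ F[β][c]` at `f`
  have key : ((Polynomial.aeval f : Polynomial (MvPolynomial β F) →ₐ[MvPolynomial β F]
      MvPolynomial β F).restrictScalars F).comp
        (optionEquivLeft F β : MvPolynomial (Option β) F →ₐ[F] Polynomial (MvPolynomial β F)) =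
      bind₁ (fun o => o.elim f X) := by
    refine MvPolynomial.algHom_ext fun o => ?_
    rcases o with _ | b
    · simp
    · simp
  have heval : Polynomial.eval f (optionEquivLeft F β H) = bind₁ (fun o => o.elim f X) H := by
    have := AlgHom.congr_fun key H
    simpa [Polynomial.coe_aeval_eq_eval] using this
  have hroot' : (optionEquivLeft F β H).IsRoot f := by rw [Polynomial.IsRoot.def, heval, hroot]
  have hdvd : (Polynomial.X - Polynomial.C f) ∣ optionEquivLeft F β H :=
    Polynomial.dvd_iff_isRoot.2 hroot'
  have h2 := map_dvd (optionEquivLeft F β).symm hdvd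
  rw [AlgEquiv.symm_apply_apply, map_sub, optionEquivLeft_symm_X] at h2
  have h3 : (optionEquivLeft F β).symm (Polynomial.C f) = rename some f := by
    rw [optionEquivLeft_symm_apply, Polynomial.aevalTower_C]
  rwa [h3] at h2

end Factoring

/-! ### The hardness-to-randomness conclusion (KI Lemma 30; KRST Lemma 8) -/

section Main

variable {F : Type*} [Field F] [CharZero F] {ι α β : Type*}
  [Fintype ι] [DecidableEq ι] [Fintype β] [DecidableEq β] [DecidableEq α]

/-- **Kabanets–Impagliazzo, Lemma 30 (with KRST Lemma 8's reading) — unconditional:** over a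
field of characteristic zero, if the blocks pairwise meet in `≤ r` points and a nonzero `D` with
`D ∘ KI-gen(f) = 0` exists, then the hard polynomial is not hard:
`L(f) ≤ (L(D) + #ι · (deg f + 1)^r (2 deg f + 2) + deg D · max 1 (deg f) + deg f + #β + 4)^7`
(hybrid argument `exists_root_of_kiGenerator_annihilated` + root closure
`complexity_le_pow_of_isRoot`). [cite: KabanetsImpagliazzo2003, Lemma 30] -/
theorem complexity_le_of_kiGenerator_annihilated
    {r : ℕ} {e : ι → (β ↪ α)} (he : IsNWDesign r e) (f : MvPolynomial β F)
    {D : MvPolynomial ι F} (hD : D ≠ 0) (hann : bind₁ (kiGenerator f e) D = 0) :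
    complexity f ≤ (complexity D +
        Fintype.card ι * ((f.totalDegree + 1) ^ r * (2 * f.totalDegree + 2)) +
        D.totalDegree * max 1 f.totalDegree + f.totalDegree + Fintype.card β + 4) ^ 7 := by
  obtain ⟨H, hH, hroot, hc, hd⟩ := exists_root_of_kiGenerator_annihilated he f hD hann
  refine (complexity_le_pow_of_isRoot f hH hroot).trans ?_
  have h3 : complexity H + H.totalDegree + f.totalDegree + Fintype.card β + 4 ≤ complexity D +
      Fintype.card ι * ((f.totalDegree + 1) ^ r * (2 * f.totalDegree + 2)) +
      D.totalDegree * max 1 f.totalDegree + f.totalDegree + Fintype.card β + 4 := by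
    gcongr
  exact Nat.pow_le_pow_left h3 7

/-- **`KI-gen(f)` is a hitting set generator against small low-degree circuits when `f` is hard**
(KRST Lemma 8 "HSG from Hardness [KI04]", tree constants; unconditional): if
`L(f) > (s + #ι · (deg f + 1)^r (2 deg f + 2) + Δ · max 1 (deg f) + deg f + #β + 4)^7` then
`D ∘ KI-gen(f) ≠ 0` for every nonzero `D` with `L(D) ≤ s` and `deg D ≤ Δ`.
[cite: KumarRamyaSaptharishiTengse2022, Lemma 8] -/
theorem kiGenerator_isHittingSetGenerator
    {r : ℕ} {e : ι → (β ↪ α)} (he : IsNWDesign r e) (f : MvPolynomial β F) {s Δ : ℕ}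
    (hhard : (s + Fintype.card ι * ((f.totalDegree + 1) ^ r * (2 * f.totalDegree + 2)) +
        Δ * max 1 f.totalDegree + f.totalDegree + Fintype.card β + 4) ^ 7 < complexity f)
    {D : MvPolynomial ι F} (hs : complexity D ≤ s) (hΔ : D.totalDegree ≤ Δ) (hD : D ≠ 0) :
    bind₁ (kiGenerator f e) D ≠ 0 := by
  intro hann
  have h := complexity_le_of_kiGenerator_annihilated he f hD hann
  have hmono : (complexity D +
        Fintype.card ι * ((f.totalDegree + 1) ^ r * (2 * f.totalDegree + 2)) +
        D.totalDegree * max 1 f.totalDegree + f.totalDegree + Fintype.card β + 4) ^ 7 ≤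
      (s + Fintype.card ι * ((f.totalDegree + 1) ^ r * (2 * f.totalDegree + 2)) +
        Δ * max 1 f.totalDegree + f.totalDegree + Fintype.card β + 4) ^ 7 := by
    gcongr
  omega

end Main

end Literature.Computability.AlgebraicComplexity

end
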